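import Mathlib.Tactic.Linarith
import Mathlib.Tactic.Ring
import Mathlib.Tactic.NormNum
import Mathlib.Data.Nat.Choose.Sum
import HarnessLib

/-!
# The (0,1) cell of the ι-window, EXCLUSION side, VIII: inside class Z — the restriction rank, silent generators, the U-move,
# and the closure of Loewy length ≤ 3; arithmetic skeleton

Family `hodge`, b2b cell `hweil`, `Summits/HodgeConjecture/HodgeConjecture/Theorems` (helper of item stmt-HodgeConjecture-2524, the Weil-sixfold rung the
H2 test serves). Companion to `WeilTypeLadderH2QuotSieveAllN.lean` (pv1-g19: THEOREM S — every point of the punctual `ι`-Quot scheme `Q = Quot^ι_x(M; n,n)`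
of local dimension `≤ 1` is of CLASS Z), SAME dictionary: `A = k[[x₁,…,x₄]]` with all coordinates `ι`-odd, `M` the canonical hull at an `ι`-fixed singular point
of `S_a` (here the two CARTIER hulls `M_𝔞` — generators `g₁ = x₄e₊ (−)`, `g₂ = qe₊ (+)`, `g₃ = x₄e₋ (+)`, `g₄ = qe₋ (−)`, `κ = s₂e₊ − s₁e₋ (−)`, relations
`r₁..r₄` — and `M⁰`), `T₀ = M/F = V₊ ⊕ V₋` a balanced quotient of length `2n`, `(P) = hom^ι(M,T₀) − end^ι(T₀)`, `d(F)` the local dimension of `Q` at `[F]`;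
class Z with socle sign `σ`, `τ = −σ`: `soc T₀ ⊂ V_σ`, `F = A·F_τ`, `a_σ = m_σ`. Report `run/shared/lean/b2b/hodge-weil/b2b-hweil-pv1-g20/H2-ZERO-ONE-8.md`
(prover 1 gen 20). Def-free, fully proved ELEMENTARY statements (integer bookkeeping); the module theory is in the docstrings and the report.
HONEST FRAMING: census / structure results about one cell of the ladder's H2 test on the exclusion side; no case of the Hodge conjecture is proved; nothing here
is a rung; no statement of [Markman 2025] is used; nothing here depends on (LP) or on 'ker ob = ann(ch)'.

PROPOSITION RES (report §1): `(P)` is the RANK of the restriction map `res : Hom^ι(M,T₀) → Hom^ι(F,T₀) = T_{[F]}Q` (its kernel is `End^ι(T₀)`), its cokernel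
embeds in `Ext¹(T₀,T₀)^ι`, and `(P) = Σ_j (dim ℌ_j − dim 𝔄_j)` over the radical layers with every term `≥ 0` (`czl3_layer_telescope`). SILENT-GENERATOR LEMMA
(§1.4): every `τ`-generator `g` of `M` that dies in `T₀/𝔪T₀` contributes `dim Sol_g` to `(P)`, `Sol_g = {t ∈ V_τ : c_k(X)t = 0}` (`c_k` the relation
coefficients of `g`), the contributions of an adapted basis of killed generators ADD (Nakayama) (`czl3_silent_sum`). INDEX LEMMA (§1.5): `M/F` balanced iff the
signed Betti sum `t(F) = Σ(−1)^i(β_i⁺ − β_i⁻)` vanishes (`t(k₊) = 16`: `czl3_koszul_trace`; `t(M_𝔞) = t(M⁰) = 0`: `czl3_index_hulls`); in class Z this gives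
`β₂^{opp} = 1 + β₁^{opp} + β₃^{opp}` and `μ = 1 + β₁^{same} − β₂^{same} + β₃^{same}` (`czl3_index_classZ`).
THEOREM U (report §2; the 'U-move'): for `u ∈ soc²(T₀)_τ ∖ soc` with `W = 𝔛u` of dimension `k`, `d(F) ≥ μ − dim(𝔖 + R(W))` and `d(F) ≥ μ − ρ(W) − k·dim(Λ/Λ_R)`
(`Λ` = linear syzygies of `F`, `𝔖` their support, `R(W)` the classes `x_a w̃`); the arithmetic of the dimension count `μ_σ(F₁^ψ) = k − dim Λ + dim 𝔎_ψ`
(`czl3_thmU_musigma`) and of the two bounds (`czl3_thmU_bounds`).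
THEOREM L3 (report §3): the graded pieces of the hulls in levels `≤ 2` have sign-dimensions `(2,3)|(10,6)|(13,22)` (`M_𝔞`, `l₂ ≠ 0`), `(2,3)|(10,7)|(16,21)`
(`l₂ = 0`), `(1,2)|(8,3)|(6,20)` (`M⁰`) (`czl3_gr_levels`); the PARITY FILTER (`F_σ = A_odd·F_τ` bounds the `σ`-classes of `F` level by level) plus BALANCE force,
for a class-Z point with `𝔪³T₀ = 0`: `σ = −`, `a₊ = 0`, `n ≤ 5` (`czl3_minus_a0_n_le_5`), `a₊ = 1, 2` impossible (`czl3_minus_a1_absurd`, `…_l2zero`,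
`czl3_minus_a2_absurd`), `σ = +` impossible unless `l₂ = 0, a = (2,0), n = 4` (`czl3_plus_n_le_4`, `czl3_plus_absurd`, `czl3_plus_l2zero_shape`), nothing on `M⁰`
(`czl3_M0_minus_a0`, `czl3_M0_minus_a1`, `czl3_M0_plus`); and at the surviving shapes `(P) ≥ n ≥ 4` by the silent generators `g₂, g₃` (`czl3_P_ge_n`), independently
`(P) ≥ 15 − r₃ − r₄ − dim 𝔄 ≥ 2` since a unital subalgebra of `M₃(k)` has dimension `≤ 7` or `= 9` (`czl3_subalgebra_count`), and `(P) ≥ 7` on the `l₂ = 0`,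
`σ = +` shape (`czl3_plus_P`). PARITY-ALTERNATION LEMMA (§3.6): if all `τ`-generators die, the radical layers alternate in sign and the Loewy length is odd
(`czl3_parity_odd`), with the Loewy-5 silent bound `p₁ − p₃` (`czl3_loewy5_silent`).

What is NOT here: modules, Quot schemes, gr, Matlis duality, Burnside's theorem, the proofs (report §§1–3); class Z ∩ {Loewy ≥ 4} is NOT closed; 0 unconditional
rungs above the floor.
-/

-- `Summit.HodgeConjecture.HodgeConjecture.…` is the mandated namespace (single-problem summit: Problem = Summit), which
-- `linter.dupNamespace` flags on every declaration; the lakefile turns the linter off tree-wide (weak option), restated here so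
-- stand-alone elaboration is warning-free too.
set_option linter.dupNamespace false

namespace Summit.HodgeConjecture.HodgeConjecture.WeilTypeLadder

section H2ClassZLoewyThree

/-- PROPOSITION RES (i) and (iii) (report §1.1): `(P) = hom − end` is the rank of `res` (its kernel is `End^ι(T₀)`), and for a three-step radical
filtration `(P) = Σ_j (h_j − e_j)` with `e_j ≤ h_j` (the top-components `𝔄_j` of endomorphisms embed in the top-components `ℌ_j` of homs), so `(P)`
dominates every single layer excess. [H2-ZERO-ONE-8 §1.1] -/
theorem czl3_layer_telescope (h0 h1 h2 e0 e1 e2 : ℕ) (l0 : e0 ≤ h0) (l1 : e1 ≤ h1) (l2 : e2 ≤ h2) :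
    (h0 + h1 + h2) - (e0 + e1 + e2) = (h0 - e0) + (h1 - e1) + (h2 - e2) ∧ h0 - e0 ≤ (h0 + h1 + h2) - (e0 + e1 + e2) := by
  omega

/-- SILENT-GENERATOR LEMMA (report §1.4): for killed `τ`-generators `g^{(1)}, …, g^{(r)}` (part of an adapted basis) the homs `g^{(i)} ↦ t_i ∈ Sol_{g^{(i)}}`,
other generators `↦ 0`, restrict injectively to `F` (if the restriction vanished, `t_i ∈ 𝔪·Σ_j A t_j` for all `i`, so `Σ A t_j = 0` by Nakayama); hence
`(P) ≥ Σ_i dim Sol_{g^{(i)}}`, and `(P) ≥ 2` as soon as the silent solution spaces have total dimension `≥ 2`. [H2-ZERO-ONE-8 §1.4] -/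
theorem czl3_silent_sum (P s₁ s₂ : ℕ) (h : s₁ + s₂ ≤ P) (h2 : 2 ≤ s₁ + s₂) : 2 ≤ P := by
  omega

/-- INDEX LEMMA, normalisation (report §1.5): the Koszul resolution of the residue field `k₊` over `A = k[[x₁,…,x₄]]` with all coordinates `ι`-odd has
`P_i = Λ^i(𝔪/𝔪²) ⊗ A` of `ι`-sign `(−1)^i` and rank `C(4,i)`, so `t(k₊) = Σ_i (−1)^i·(−1)^i·C(4,i) = Σ_i C(4,i) = 16` — the normalisation of the certified index
dictionary `t_x(T) = 16(ℓ₊ − ℓ₋)`. [H2-ZERO-ONE-8 §1.5] -/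
theorem czl3_koszul_trace : (Finset.range 5).sum (fun i => Nat.choose 4 i) = 16 := by
  decide

/-- INDEX LEMMA, the hulls (report §1.5): `t(M_𝔞) = (2 − 3) − (2 − 2) + (1 − 0) = 0` (generators `(2₊,3₋)`, relations `(2₊,2₋)`, one second syzygy
`q·r₃ − x₄·r₄ + s₂·r₁ − s₁·r₂` of sign `+`) and `t(M⁰) = (1 − 2) − (0 − 1) = 0`: the index-0 hulls; so `M/F` is balanced iff `t(F) = 0`.
[H2-ZERO-ONE-8 §1.5] -/
theorem czl3_index_hulls : ((2 : ℤ) - 3) - (2 - 2) + (1 - 0) = 0 ∧ ((1 : ℤ) - 2) - (0 - 1) = 0 := by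
  norm_num

/-- INDEX LEMMA in class Z (report §1.5): all `μ` generators of `F` have sign `τ`; write `bᵢs`/`bᵢo` for the numbers of `i`-th syzygy generators of sign
equal / opposite to `τ`. Then `rank F = 2` (`μ − β₁ + β₂ − β₃ = 2`) and balance (`t(F) = 0`, i.e. `μ − (b₁s − b₁o) + (b₂s − b₂o) − (b₃s − b₃o) = 0`) give
`b₂o = 1 + b₁o + b₃o` and `μ = 1 + b₁s − b₂s + b₃s`: a class-Z kernel always has a second syzygy of the opposite sign. [H2-ZERO-ONE-8 §1.5] -/
theorem czl3_index_classZ (μ b₁s b₁o b₂s b₂o b₃s b₃o : ℤ)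
    (hchi : μ - (b₁s + b₁o) + (b₂s + b₂o) - (b₃s + b₃o) = 2)
    (ht : μ - (b₁s - b₁o) + (b₂s - b₂o) - (b₃s - b₃o) = 0) :
    b₂o = 1 + b₁o + b₃o ∧ μ = 1 + b₁s - b₂s + b₃s := by
  constructor <;> linarith

/-- THEOREM U, the dimension count (report §2.2 (4)): in the chart `ψ`, `(F₁^ψ)_σ = F_σ ⊕ W̃` and `(𝔪F₁^ψ)_σ = Ω_ψ ⊇ (𝔪²F)_σ`; with
`dim 𝒱 = (4μ − dim Λ) + k` (`F_σ/(𝔪²F)_σ ≅ ((𝔪/𝔪²)⊗(F/𝔪F))/Λ`) and `rank Ω_ψ = 4μ − dim 𝔎_ψ` one gets `μ_σ(F₁^ψ) = k − dim Λ + dim 𝔎_ψ`; so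
`H_ψ` lies in the closed set `𝔓 = {μ_σ ≥ k}` iff `dim 𝔎_ψ ≥ dim Λ`. [H2-ZERO-ONE-8 §2.2] -/
theorem czl3_thmU_musigma (μ k dΛ dK musig : ℤ) (hμσ : musig = (4 * μ - dΛ + k) - (4 * μ - dK)) :
    musig = k - dΛ + dK ∧ (k ≤ musig ↔ dΛ ≤ dK) := by
  refine ⟨by linarith, ?_⟩
  constructor <;> intro h <;> linarith

/-- THEOREM U, the two bounds (report §2.2 (5)(6)): the injective family `Φ : 𝔓° → Q(n,n)` through `[F]` gives `d(F) ≥ dim_{H₀} 𝔓`; (a) `𝔓 ⊇ C₀ =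
Ann(𝔖 + R(W))`, a linear space of dimension `μ − dim(𝔖 + R(W))`; (b) in the chart of dimension `μ − ρ(W)`, `𝔓` is a determinantal locus 'rank ≤ 4 − k' of
codimension `≤ k·dim(Λ/Λ_R)` at `H₀`. Arithmetic form: both quantities are lower bounds for `d(F)`. [H2-ZERO-ONE-8 §2.2] -/
theorem czl3_thmU_bounds (d μ dSR ρ k q dimP : ℤ) (hΦ : dimP ≤ d) (ha : μ - dSR ≤ dimP) (hb : (μ - ρ) - k * q ≤ dimP) :
    μ - dSR ≤ d ∧ μ - ρ - k * q ≤ d := by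
  constructor <;> linarith

/-- LEMMA 3.1 (report §3.1; machine-confirmed): the graded pieces `𝔪^kM/𝔪^{k+1}M` in levels `1, 2`. `M_𝔞`, `l₂ ≠ 0`: level 1 `(+)`: `x_a ⊗ {g₁,g₄,κ}`
(12) minus the leading forms `x₄⊗g₄`, `x₄⊗κ − l₂⊗g₁` gives 10; `(−)`: `x_a ⊗ {g₂,g₃}` (8) minus `x₄⊗g₂`, `l₂⊗g₂` gives 6; level 2 `(+)`: even quadrics `⊗ {g₂,g₃}`
(20) minus `span{x_ax₄⊗g₂, x_al₂⊗g₂}` (4 + 4 − 1 = 7) gives 13; `(−)`: even quadrics `⊗ {g₁,g₄,κ}` (30) minus 8 gives 22. `l₂ = 0`: 7, 16 = 20 − 4, 21 = 30 − 8 − 1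
(the extra leading form `q⊗κ + s₁^{(2)}⊗g₄` of `r₄`). `M⁰`: `(8, 4 − 1) | (10 − 4, 20)`. [H2-ZERO-ONE-8 §3.1] -/
theorem czl3_gr_levels :
    (12 - 2 = 10 ∧ 8 - 2 = 6 ∧ 20 - (4 + 4 - 1) = 13 ∧ 30 - 8 = 22) ∧
    (8 - 1 = 7 ∧ 20 - 4 = 16 ∧ 30 - 8 - 1 = 21) ∧
    (4 - 1 = 3 ∧ 10 - 4 = 6) := by
  norm_num

/-- PROPOSITION 3.3 (A), `σ = −`, `a₊ = 0` (report §3.3): `e₂ = n − 3` (balance, `d₁ = 0`, `p = n`) and the parity filter `e₂ ≥ 22 − 4(10 − n) − 2 = 4n − 20`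
(resp. `21 − 4(10 − n) − 1` when `l₂ = 0`) force `3n ≤ 17`, i.e. `n ≤ 5`; with `n ≥ 4` the Loewy-3 class-Z points of `M_𝔞` have `n ∈ {4, 5}` and layers
`(0,3) | (n,0) | (0,n−3)`. [H2-ZERO-ONE-8 §3.3 (A)] -/
theorem czl3_minus_a0_n_le_5 (n e₂ : ℤ) (hbal : e₂ = n - 3) (hα : 4 * n - 20 ≤ e₂) (hn : 4 ≤ n) : n = 4 ∨ n = 5 := by
  omega

/-- PROPOSITION 3.3 (A), `σ = −`, `a₊ = 1` is impossible, `l₂ ≠ 0` (report §3.3): killed combination `g′ = αg₂ + βg₃`; `(d₁, c₂) = (2, 0)` if `β ≠ 0`,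
`(4, ≤ 2)` if `g₂` is killed; balance `e₂ = p − 2 − d₁`, parity filter `e₂ ≥ 4p − 18 − c₂`, injectivity of `𝔛` on `P` (`P ∩ soc = 0`) `4e₂ ≥ p`: no solution.
[H2-ZERO-ONE-8 §3.3 (A)] -/
theorem czl3_minus_a1_absurd (p d₁ c₂ e₂ : ℤ) (hd : (d₁ = 2 ∧ c₂ = 0) ∨ (d₁ = 4 ∧ c₂ ≤ 2))
    (hbal : e₂ = p - 2 - d₁) (hα : 4 * p - 18 - c₂ ≤ e₂) (hβ : p ≤ 4 * e₂) : False := by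
  omega

/-- PROPOSITION 3.3 (A), `σ = −`, `a₊ = 1`, the `l₂ = 0` variant (report §3.3): `gr₁(M)₋ = 7`, `gr₂(M)₋ = 21`; `(d₁, c₂) = (3, 0)` or `(4, ≤ 1)`;
`e₂ = p − 2 − d₁`, `e₂ ≥ 21 − 4(10 − p) − c₂ = 4p − 19 − c₂`, `4e₂ ≥ p`: no solution. [H2-ZERO-ONE-8 §3.3 (A)] -/
theorem czl3_minus_a1_absurd_l2zero (p d₁ c₂ e₂ : ℤ) (hd : (d₁ = 3 ∧ c₂ = 0) ∨ (d₁ = 4 ∧ c₂ ≤ 1))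
    (hbal : e₂ = p - 2 - d₁) (hα : 4 * p - 19 - c₂ ≤ e₂) (hβ : p ≤ 4 * e₂) : False := by
  omega

/-- PROPOSITION 3.3 (A), `σ = −`, `a₊ = 2` is impossible (report §3.3): no killed `(+)`-generator, so `d₁ = 6` (resp. `7`), `c₂ = 0`, `e₂ = p − 1 − d₁ ≥ 0`
and `e₂ ≥ 4p − 18` (resp. `4p − 19`): `p ≥ 7` and `3p ≤ 11` (resp. `12`). [H2-ZERO-ONE-8 §3.3 (A)] -/
theorem czl3_minus_a2_absurd (p d₁ e₂ : ℤ) (hd : 6 ≤ d₁) (hbal : e₂ = p - 1 - d₁) (hα : 4 * p - 19 ≤ e₂) (he : 0 ≤ e₂) : False := by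
  omega

/-- PROPOSITION 3.3 (B), `σ = +` (report §3.3): `d_U ≥ 4a₋ − 2` (level-1 `(+)`-classes of `F` are `x_a ⊗` killed `(−)`-generators, at most `4(3 − a₋)` of 10),
`e ≥ 13 − 4(6 − p′) − c₂ = 4p′ − 11 − c₂` with `c₂ ≤ 2` (resp. `4p′ − 12 − c₂` for `l₂ = 0`), balance `a₋ + p′ = 2 + d_U + e`: hence `n = a₋ + p′ ≤ 4`.
[H2-ZERO-ONE-8 §3.3 (B)] -/
theorem czl3_plus_n_le_4 (a p dU e c₂ : ℤ) (hdU : 4 * a - 2 ≤ dU) (he : 4 * p - 12 - c₂ ≤ e) (hc : c₂ ≤ 2)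
    (hbal : a + p = 2 + dU + e) : a + p ≤ 4 := by
  omega

/-- PROPOSITION 3.3 (B), `σ = +`, `l₂ ≠ 0`: NO Loewy-3 class-Z point (report §3.3): with `n = a₋ + p′ = 4`, `d_U ≥ max(0, 4a₋ − 2)`, `e ≥ 1` (`P′ ≠ 0` and
`P′ ∩ soc = 0`), balance forces `a₋ = 0`, `p′ = 4`, `e ≤ 2`, while the parity filter for `l₂ ≠ 0` demands `e ≥ 4·4 − 11 − c₂ ≥ 3`. [H2-ZERO-ONE-8 §3.3 (B)] -/
theorem czl3_plus_absurd (a p dU e c₂ : ℤ) (ha : 0 ≤ a) (hdU0 : 0 ≤ dU) (hdU : 4 * a - 2 ≤ dU) (he1 : 1 ≤ e)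
    (he : 4 * p - 11 - c₂ ≤ e) (hc : c₂ ≤ 2) (hbal : a + p = 2 + dU + e) (hn : a + p = 4) : False := by
  omega

/-- PROPOSITION 3.3 (B), `σ = +`, `l₂ = 0`: the only surviving shape (report §3.3): the same bookkeeping with `e ≥ 4p′ − 12 − c₂` leaves exactly `a₋ = 0`,
`p′ = 4`, `d_U + e = 2` with `e = 2`, `d_U = 0` — layers `(2,0) | (0,4) | (2,0)`, `n = 4`. [H2-ZERO-ONE-8 §3.3 (B)] -/
theorem czl3_plus_l2zero_shape (a p dU e c₂ : ℤ) (ha : 0 ≤ a) (hdU0 : 0 ≤ dU) (hdU : 4 * a - 2 ≤ dU) (he1 : 1 ≤ e)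
    (he : 4 * p - 12 - c₂ ≤ e) (hc : c₂ ≤ 2) (hbal : a + p = 2 + dU + e) (hn : a + p = 4) : a = 0 ∧ p = 4 ∧ e = 2 ∧ dU = 0 := by
  omega

/-- PROPOSITION 3.3 (C), `M⁰`, `σ = −`, `a₊ = 0` (report §3.3): `e₂ = n − 2` and `e₂ ≥ 20 − 4(8 − n) − 1 = 4n − 13` give `3n ≤ 11`: no point with `n ≥ 4`.
[H2-ZERO-ONE-8 §3.3 (C)] -/
theorem czl3_M0_minus_a0 (n : ℤ) (hα : 4 * n - 13 ≤ n - 2) (hn : 4 ≤ n) : False := by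
  omega

/-- PROPOSITION 3.3 (C), `M⁰`, `σ = −`, `a₊ = 1` (report §3.3): `h₃` survives, `d₁ = 3` (only `X₄u₃ = q(X)u₂ ∈ 𝔪²` is forced), `c₂ = 0`, `e₂ = (1 + p) − 2 − 3 =
p − 4 ≥ 0` and `e₂ ≥ 4p − 12`: `p ≥ 4` and `3p ≤ 8`. [H2-ZERO-ONE-8 §3.3 (C)] -/
theorem czl3_M0_minus_a1 (p e₂ : ℤ) (hbal : e₂ = p - 4) (hα : 4 * p - 12 ≤ e₂) (he : 0 ≤ e₂) : False := by
  omega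

/-- PROPOSITION 3.3 (D), `M⁰`, `σ = +` (report §3.3): `X₄u₃ = 0`, so `p′ = dim 𝔛u₃ ≤ 3`; `d_U ≥ 4a₋` (no linear relation of `M⁰` involves `h₁, h₂`), `e ≥ 1`,
balance `a₋ + p′ = 1 + d_U + e`: then `p′ ≥ 3a₋ + 2`, so `a₋ = 0` and `n = p′ ≤ 3`. [H2-ZERO-ONE-8 §3.3 (D)] -/
theorem czl3_M0_plus (a p dU e : ℤ) (ha : 0 ≤ a) (hdU : 4 * a ≤ dU) (he1 : 1 ≤ e) (hbal : a + p = 1 + dU + e) (hp : p ≤ 3)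
    (hn : 4 ≤ a + p) : False := by
  omega

/-- PROPOSITION 3.4 (i) (report §3.4): at a Loewy-3 class-Z point of `M_𝔞` (`σ = −`, `a₊ = 0`, `n ∈ {4,5}`) both `(+)`-generators `g₂, g₃` are killed and
`Sol_{g₃} = ker q(X) ∩ ker s₁(X) ∩ V₊ = V₊` (`q, s₁ ∈ 𝔪²` act through `𝔛²`, and `𝔛²V₊ ⊂ 𝔪³T₀ = 0`), so by the silent-generator lemma `(P) ≥ dim V₊ +
dim Sol_{g₂} ≥ n ≥ 4 ≥ 2`, hence `d(F) ≥ 2`. [H2-ZERO-ONE-8 §3.4] -/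
theorem czl3_P_ge_n (P n s₂ : ℕ) (h : n + s₂ ≤ P) (hn : 4 ≤ n) : 2 ≤ P := by
  omega

/-- PROPOSITION 3.4 (i), second count (report §3.4): `hom^ι ≥ 5n − 2(n − 3) − r₃ − r₄` and `end^ι = dim 𝔄 + 3(n − 3)` give `(P) ≥ 15 − r₃ − r₄ − dim 𝔄`
with `r₄ = rank(X₄|_U) ≤ 2`, `r₃ ≤ 4`, and `𝔄 ⊂ M₃(k)` a unital subalgebra — of dimension `≤ 7` (parabolic) or `= 9`, never 8 (Burnside); `dim 𝔄 = 9` forces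
`X₄ = X_{l₂} = 0` on `U`, i.e. `r₃ = r₄ = 0`. In all cases `(P) ≥ 2`. [H2-ZERO-ONE-8 §3.4] -/
theorem czl3_subalgebra_count (r₃ r₄ dA : ℤ) (h3 : r₃ ≤ 4) (h4 : r₄ ≤ 2) (h3' : 0 ≤ r₃) (h4' : 0 ≤ r₄)
    (hA : dA ≤ 7 ∨ (dA = 9 ∧ r₃ = 0 ∧ r₄ = 0)) : 2 ≤ 15 - r₃ - r₄ - dA := by
  omega

/-- PROPOSITION 3.4 (ii) (report §3.4): on the `l₂ = 0`, `σ = +`, `n = 4` shape `(2,0)|(0,4)|(2,0)`: `hom^ι ≥ 20 − 1 − 2 − 2 − 0 = 15` ((E1) costs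
`rank(X₄ : T′ → P′) ≤ 1`, (E2), (E3) land in the 2-dimensional `𝔛²T′`, (E4) costs `rank s₂(X) = 0`), `end^ι ≤ dim 𝔄 + 4 ≤ 8`, so `(P) ≥ 7`.
[H2-ZERO-ONE-8 §3.4] -/
theorem czl3_plus_P (hom en dA : ℤ) (hhom : 20 - 1 - 2 - 2 - 0 ≤ hom) (hA : dA ≤ 4) (hend : en ≤ dA + 4) : 7 ≤ hom - en := by
  omega

/-- PARITY-ALTERNATION LEMMA (report §3.6): if every `τ`-generator of `M` dies in `T₀/𝔪T₀`, layer `k` of `T₀` has sign `σ·(−1)^k`; the last layer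
(index `L − 1`) lies in the socle, of sign `σ`, so `L − 1` is even and the Loewy length `L` is ODD — in particular `σ = −, a₊ = 0` never has Loewy length 4.
[H2-ZERO-ONE-8 §3.6] -/
theorem czl3_parity_odd (L : ℕ) (hL : 1 ≤ L) (h : (L - 1) % 2 = 0) : L % 2 = 1 := by
  omega

/-- PARITY-ALTERNATION, the Loewy-5 silent bound (report §3.6 (i)): with alternating layers `(0,3)|(p₁,0)|(0,e₂)|(p₃,0)|(0,e₄)`, `Sol_{g₃} ⊇ P₃ ⊕ (P₁ ∩
ker q(X) ∩ ker s₁(X))` has dimension `≥ p₃ + (p₁ − 2p₃) = p₁ − p₃` (`= 4` on the census shape `p₁ = 5, p₃ = 1`). [H2-ZERO-ONE-8 §3.6] -/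
theorem czl3_loewy5_silent (p₁ p₃ : ℤ) : p₃ + (p₁ - 2 * p₃) = p₁ - p₃ ∧ ((5 : ℤ) - 1 = 4) := by
  constructor
  · ring
  · norm_num

end H2ClassZLoewyThree

section H2ClassZLoewyFour

/-!
### ADDENDUM (same seat): Loewy length 4 on `M_𝔞` — PROPOSITIONS 3.7 / 3.8 of the report

`σ = −`: (a) `a₊ = 0` impossible (parity alternation); (b) killed `(+)`-combination not proportional to `qe₊` ⇒ `(P) ≥ n − 2`
(`q(X), s₁(X)` have rank `≤ 1` on `V₊` because the last layer is `(−)`); (c) `x₄e₋` on top, `qe₊` killed: the family EXISTS (machine, `n = 9..11`);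
the odd operators `X₄, s₂(X)` map `V₊ = k·u₃ ⊕ (𝔪T₀)₊` into spaces of dimension `≤ 1 + e₂ + e₃ = n − 6`, so `dim Sol ≥ 12 − n`: closed for `n ≤ 10`,
OPEN for `n ≥ 11`. `σ = +`: `a₋ = 1` ⇒ two 'cheap' functionals independent on the killed plane exist, each with a silent family of dimension
`≥ n − a₋ − (n − 2) = 1`, so `(P) ≥ 2`; `a₋ = 2` gives only `2 − a₋ = 0`. [H2-ZERO-ONE-8 §3.7–3.8]
-/

/-- PROPOSITION 3.7 (b) (report §3.7): `σ = −`, Loewy 4, the killed `(+)`-combination `αg₂ + βg₃` has `β ≠ 0`; in the adapted basis its relation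
coefficients are `(q/β, s₁/β) ∈ 𝔪²`, and an even element of `𝔪²` has rank `≤ 1` on `V₊ = kt ⊕ P₁ ⊕ P₂` (it maps `t` into `P₂`, `P₁` into
`(𝔪³T₀)₊ = 0`, `P₂` into `𝔪⁴T₀ = 0`); so `dim Sol ≥ n − r₁ − r₂ ≥ n − 2 ≥ 2`. [H2-ZERO-ONE-8 §3.7] -/
theorem czl4_minus_generic (n r₁ r₂ : ℤ) (h1 : r₁ ≤ 1) (h2 : r₂ ≤ 1) (hn : 4 ≤ n) : 2 ≤ n - r₁ - r₂ := by
  omega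

/-- PROPOSITION 3.7 (c) (report §3.7): `σ = −`, Loewy 4, `x₄e₋` on top, `qe₊` killed: balance reads `n = 3 + d₁ + e₂ + e₃` with `d₁ = 4`
(`𝔛u₃` is free modulo `𝔪²`), the odd operators `X₄`, `s₂(X)` have rank `≤ 1 + e₂ + e₃` on `V₊`, hence `dim Sol_{g₂} ≥ n − 2(1 + e₂ + e₃) = 12 − n`;
for `n ≤ 10` this is `≥ 2` and the point is closed. [H2-ZERO-ONE-8 §3.7] -/
theorem czl4_family_c (n e₂ e₃ rX rS sol : ℤ) (hbal : n = 3 + 4 + e₂ + e₃) (hX : rX ≤ 1 + e₂ + e₃) (hS : rS ≤ 1 + e₂ + e₃)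
    (hsol : n - rX - rS ≤ sol) : 12 - n ≤ sol ∧ (n ≤ 10 → 2 ≤ sol) := by
  constructor
  · omega
  · intro hn; omega

/-- PROPOSITION 3.8 (b) (report §3.8): `σ = +`, Loewy 4, `a₋ = 1`: for a 'cheap' functional `λ` (`λ₄ = 0` or `λ₁ = 0`) the silent family has
`dim Sol_λ ≥ n − a₋·1 − (n − 2) = 2 − a₋ = 1` (one even condition of rank `≤ a₋`, one odd condition of rank `≤ dim (𝔪T₀)₊ = n − 2`), and two cheap
functionals independent on the killed plane always exist (if `g₄ ∈ K` use `Λ₁`, if `g₁ ∈ K` use `Λ₄`, if both then `g₁^*, g₄^*`), so `(P) ≥ 1 + 1 = 2`;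
for `a₋ = 2` the same count gives only `0`. [H2-ZERO-ONE-8 §3.8] -/
theorem czl4_plus_cheap (n a s₁ s₂ P : ℤ) (ha : a = 1) (h1 : n - a - (n - 2) ≤ s₁) (h2 : n - a - (n - 2) ≤ s₂) (hP : s₁ + s₂ ≤ P) :
    2 ≤ P ∧ (n - 2 - (n - 2) = 0) := by
  constructor
  · omega
  · ring

end H2ClassZLoewyFour

section H2ClassZUniform

/-!
### ADDENDUM 2 (same seat): the uniform silent bounds of report §3.9 — in particular the `M⁰` THEOREM (all Loewy lengths)

`M⁰ = 𝓘_S e₊ ⊕ A e′` has a FREE summand: the generator `e′` has no relation coefficient, `x₄e₊` has coefficient `q`, `qe₊` has coefficient `−x₄`.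
`σ = −`: the killed generator is `qe₊`, `Sol = ker X₄ ∩ V₊` has dimension `≥ n − dim(𝔪T₀)₋ = 2`. `σ = +`: if a killed `(−)`-combination involves `e′`, the
functional vanishing on `x₄e₊` imposes NO condition and `(P) ≥ n`; if exactly `x₄e₊` dies, `Sol = ker q(X) ∩ V₋` has dimension `≥ n − 1 − dim(𝔪³T₀)₋`.
So on `M⁰` class Z is closed except CASE B and the thin family `dim(𝔪³T₀)₋ ≥ n − 2`. For `M_𝔞` the even/odd rank facts give the table of §3.9.
-/

/-- PROPOSITION 3.9 (I)(i) (report §3.9): `M⁰`, `σ = −`, `a₊ = 0`: `qe₊` is killed, its only relation coefficient is `−x₄`, and `X₄` maps `V₊` into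
`(𝔪T₀)₋` of dimension `n − a₋ = n − 2`; so `dim Sol ≥ n − (n − 2) = 2` and `(P) ≥ 2` for every `n` and every Loewy length. [H2-ZERO-ONE-8 §3.9] -/
theorem czl9_M0_minus (n r sol : ℤ) (hr : r ≤ n - 2) (hsol : n - r ≤ sol) : 2 ≤ sol := by
  omega

/-- PROPOSITION 3.9 (I)(ii) (report §3.9): `M⁰`, `σ = +`: if a killed `(−)`-combination has a non-zero `e′`-component, the silent family imposes no condition
(`Sol = V₋`, `(P) ≥ n ≥ 4`); if exactly `x₄e₊` dies, `Sol = ker q(X) ∩ V₋` with `rank q(X)|_{V₋} ≤ 1 + dim(𝔪³T₀)₋`, so `(P) ≥ n − 1 − dim(𝔪³T₀)₋`, which is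
`≥ 2` unless `dim(𝔪³T₀)₋ ≥ n − 2`. [H2-ZERO-ONE-8 §3.9] -/
theorem czl9_M0_plus (n m₃ P : ℤ) (hn : 4 ≤ n) (hcase : n ≤ P ∨ n - 1 - m₃ ≤ P) (hm : m₃ ≤ n - 3) : 2 ≤ P := by
  omega

/-- PROPOSITION 3.9 (II) (report §3.9): `M_𝔞`, `σ = −`, `a₊ = 0` (alternating layers `(0,3)|(p₁,0)|(0,e₂)|(p₃,0)|(0,e₄)|(p₅,0)|…`): the functional `g₃^*`
imposes two EVEN conditions, each of rank `≤ dim(𝔪³T₀)₊ = p₃ + p₅ + …`, so `dim Sol ≥ n − 2(p₃ + p₅ + …) = p₁ − (p₃ + p₅ + …)` with `n = p₁ + p₃ + p₅ + …`.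
[H2-ZERO-ONE-8 §3.9] -/
theorem czl9_alternating (p₁ deep n : ℤ) (hn : n = p₁ + deep) : n - 2 * deep = p₁ - deep := by
  subst hn; ring

/-- PROPOSITION 3.9 (III) / 3.8 (b) (report §3.9): `M_𝔞`, `σ = +`, `a₋ = 1`: each of two cheap functionals independent on the killed plane gives
`dim Sol ≥ n − (a₋ + dim(𝔪³T₀)₋) − (n − 2) = 1 − dim(𝔪³T₀)₋`, so `(P) ≥ 2·(1 − dim(𝔪³T₀)₋)`: `= 2` when `(𝔪³T₀)₋ = 0` (Loewy 4), nothing otherwise.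
[H2-ZERO-ONE-8 §3.9] -/
theorem czl9_plus_a1 (n m₃ s₁ s₂ P : ℤ) (h1 : n - (1 + m₃) - (n - 2) ≤ s₁) (h2 : n - (1 + m₃) - (n - 2) ≤ s₂) (hP : s₁ + s₂ ≤ P) :
    2 - 2 * m₃ ≤ P := by
  omega

end H2ClassZUniform

section H2ClassZCaseBCorner

/-!
### ADDENDUM 3 (same seat): the CASE-B corner and the thresholds of report §3.9 (table)

In Loewy length 4 on `M_𝔞` (`l₂ ≠ 0`) a CASE-B point (all five generators survive) with `σ = −` has `n = 9 + e₂ + e₃`, with `σ = +` has `n = 12 + e₂ + e₃`;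
top generators in the socle make `T₀` decomposable and H2-ZERO-ONE-7 5.1 (a) applies, except the corner `σ = −`, all three `(−)`-tops in the socle, which the
parity filter empties: `p₂ = 7 + e₃`, `p₂ ≤ 4e₃`, `e₃ ≥ 24 − 4(13 − p₂) − 8`. Hence every class-Z point of `M_𝔞` (`l₂ ≠ 0`) with Loewy length `≤ 4` and `n ≤ 10`
has local dimension `≥ 2`. [H2-ZERO-ONE-8 §3.9]
-/

/-- The CASE-B corner is empty (report §3.9, table): `σ = −`, Loewy 4, `u₁, u₄, u₅ ∈ soc`: then `𝔪⟨g₁,g₄,κ⟩ ⊂ F`, `p₁ = 0`, `d₁ = 6`, `e₂ = 0`, balance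
`2 + p₂ = 9 + e₃`; `P₂ ∩ soc = 0` gives `p₂ ≤ 4e₃`; the level-3 `(−)`-classes of `F` number at most `4(13 − p₂) + 8`, so `e₃ ≥ 24 − 4(13 − p₂) − 8`.
No integer solution. [H2-ZERO-ONE-8 §3.9] -/
theorem czlB_corner_empty (p₂ e₃ : ℤ) (hbal : 2 + p₂ = 9 + e₃) (hsoc : p₂ ≤ 4 * e₃) (hlev3 : 24 - 4 * (13 - p₂) - 8 ≤ e₃) : False := by
  omega

/-- The CASE-B thresholds in Loewy 4 (report §3.9, table): with no top generator in the socle (`j = 0`, so `e₂ + e₃ = s ≥ 2`), `σ = −` gives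
`n = 9 + e₂ + e₃ ≥ 11` and `σ = +` gives `n = 12 + e₂ + e₃ ≥ 14`; so a class-Z point with `n ≤ 10` and Loewy length `≤ 4` is never CASE B.
[H2-ZERO-ONE-8 §3.9] -/
theorem czlB_thresholds (n e₂ e₃ : ℤ) (hs : 2 ≤ e₂ + e₃) :
    (n = 9 + e₂ + e₃ → 11 ≤ n) ∧ (n = 12 + e₂ + e₃ → 14 ≤ n) := by
  constructor <;> intro h <;> omega

end H2ClassZCaseBCorner

section H2ClassZNoTauSocle

/-!
### ADDENDUM 4 (same seat): the no-τ-socle inequalities and the corrected CASE-B thresholds (report §3.9)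

Since `soc T₀ ⊂ V_σ`, the map `v ↦ (X₁v,…,X₄v)` is injective on `(𝔪^k T₀)_τ` with values in `((𝔪^{k+1}T₀)_σ)⁴`, so
`dim (𝔪^k T₀)_τ ≤ 4 · dim (𝔪^{k+1} T₀)_σ` for every `k`. In Loewy length 4 this gives, for CASE B (`F ⊂ 𝔪M`), `n ≥ 12` when `σ = −` and `n ≥ 15` when
`σ = +` on `M_𝔞`, and `n ≥ 7` resp. `n ≥ 12` on `M⁰`. These supersede `czlB_thresholds` (whose hypothesis `2 ≤ e₂ + e₃` is implied by the k = 1 inequality,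
which in fact gives `3 ≤ e₂ + e₃`). [H2-ZERO-ONE-8 §3.9]
-/

/-- CASE B, `σ = −`, Loewy 4 on `M_𝔞` (report §3.9): `n₊ = 2 + p₁ + p₂`, `n₋ = 9 + e₂ + e₃` (`d₁ = 6` because `F₋ ⊂ 𝔪²M`), and the no-τ-socle inequality at
`k = 1`, `p₁ + p₂ ≤ 4(e₂ + e₃)`, force `n ≥ 12`. [H2-ZERO-ONE-8 §3.9] -/
theorem czlB_minus_n_ge_12 (n p₁ p₂ e₂ e₃ : ℤ) (hp : n = 2 + p₁ + p₂) (hm : n = 9 + e₂ + e₃) (hinj : p₁ + p₂ ≤ 4 * (e₂ + e₃)) : 12 ≤ n := by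
  omega

/-- CASE B, `σ = +`, Loewy 4 on `M_𝔞` (report §3.9): `n₊ = 12 + p₂ + p₃` (`p₁ = 10` because `F₊ ⊂ 𝔪²M`), `n₋ = 3 + d₁ + e₂`, and the no-τ-socle inequality
`d₁ + e₂ ≤ 4(p₂ + p₃)` force `n ≥ 15`. [H2-ZERO-ONE-8 §3.9] -/
theorem czlB_plus_n_ge_15 (n p₂ p₃ d₁ e₂ : ℤ) (hp : n = 12 + p₂ + p₃) (hm : n = 3 + d₁ + e₂) (hinj : d₁ + e₂ ≤ 4 * (p₂ + p₃)) : 15 ≤ n := by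
  omega

/-- CASE B on `M⁰` (report §3.9): `σ = −`: `n₊ = 1 + p₁ + p₂`, `n₋ = 5 + e₂ + e₃` (`d₁ = 3`), `p₁ + p₂ ≤ 4(e₂ + e₃)` ⇒ `n ≥ 7`; `σ = +`: `n₊ = 9 + p₂ + p₃`
(`p₁ = 8`), `n₋ = 2 + d₁ + e₂`, `d₁ + e₂ ≤ 4(p₂ + p₃)` ⇒ `n ≥ 12`. [H2-ZERO-ONE-8 §3.9] -/
theorem czlB_M0_thresholds (n p₁ p₂ p₃ d₁ e₂ e₃ : ℤ) :
    (n = 1 + p₁ + p₂ → n = 5 + e₂ + e₃ → p₁ + p₂ ≤ 4 * (e₂ + e₃) → 7 ≤ n) ∧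
    (n = 9 + p₂ + p₃ → n = 2 + d₁ + e₂ → d₁ + e₂ ≤ 4 * (p₂ + p₃) → 12 ≤ n) := by
  constructor <;> intro h1 h2 h3 <;> omega

/-- The same inequality on the family 3.7 (c) (`σ = −`, `n₊ = 1 + p₁ + p₂`, `n₋ = 7 + e₂ + e₃`) only gives `n ≥ 9` — consistent with its observed members
`n = 9, 10, 11` (report §3.9). [H2-ZERO-ONE-8 §3.9] -/
theorem czlB_family_c_n_ge_9 (n p₁ p₂ e₂ e₃ : ℤ) (hp : n = 1 + p₁ + p₂) (hm : n = 7 + e₂ + e₃) (hinj : p₁ + p₂ ≤ 4 * (e₂ + e₃)) : 9 ≤ n := by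
  omega

end H2ClassZNoTauSocle

end Summit.HodgeConjecture.HodgeConjecture.WeilTypeLadder
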